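import Literature.NumberTheory.Irrationality.PAdicZetaValues.HurwitzLemma27Proofs
import Literature.NumberTheory.Irrationality.PAdicZetaValues.Records
import Mathlib.NumberTheory.Padics.RingHoms
import HarnessLib

/-!
# The reflection formula `ζ_p(s, x) = ζ_p(s, 1 − x)` for the `p`-adic Hurwitz zeta values — PROVED,
# with Lai's Lemma 2.7 at `p = 3` (`ζ₃(j) = ⅔ ζ₃(j, ⅓)`) and Beukers' `T₃(⅓) = 3³ζ₃(3)`

Sources.  L. Lai, *On the irrationality of certain 2-adic zeta values*, Int. J. Number Theory 21 (2025) =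
arXiv:2304.00816 [Lai2025TwoAdicZeta], §2.3: «For `x ∈ ℚ_p` with `|x|_p ≥ q_p` … `ζ_p(s,x) =
(1/(s−1))∫_{ℤ_p}⟨x+t⟩^{1−s}dt` … Moreover, we have the reflection formula [Coh07, …]: `ζ_p(s, x) = ζ_p(s, 1 − x)`»
[(2.1)], and Lemma 2.7: «for any odd integer `j ≥ 3`, `ζ_p(j) = (1/q_p) Σ_{a, p∤a} ω(a)^{1−j} ζ_p(j, a/q_p)
= (2/q_p) Σ_{0<a<q_p/2, p∤a} ω(a)^{1−j} ζ_p(j, a/q_p)`» [Cohen2007NumberTheoryII, §11.2 is the cited source of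
(2.1)].  A. M. Robert, *A Course in p-adic Analysis* [Robert2000PadicAnalysis], Ch. V §5.3 Proposition 4:
«Let `σ` denote the involution `x ↦ −1 − x` of `ℤ_p`.  Then `∫(f ∘ σ) = ∫ f`» (tree:
`LocalFields.tendsto_volkenbornSum_comp_sigma`).  F. Beukers, *Irrationality of some p-adic L-values*,
Acta Math. Sin. 24 (2008) = arXiv:math/0603277 [Beukers2008], §1 «`T(x) = Σ_{n≥0}(n+1)B_n(−1/x)^{n+2}`», §5
«The series obtained from … `T(x)` by the substitution `x = a/F` are `p`-adically convergent. We denote the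
`p`-adic values of these series by … `T_p(a/F)`», Corollary 8 «`T(x) = T(1−x)`», Proposition 10 «`T₃(1/3) =
3³ζ₃(3)`», Corollary 23 «the following numbers are irrational: `ζ₂(3), ζ₃(3), …`» (= [Calegari2005, Thm 3.4]
for `ζ₃(3)`).  Held texts: `paper:arxiv-2304.00816` (chunks p0003–p0004), `paper:arxiv-math_0603277`
(chunks p0003, p0006, p0008, p0013–p0014), read on the page.

PROOF FILE (theorems only; no definition, no named fact; net debt 0).  What is formalised, for the
TREE's `padicHurwitzZeta p s x = (1/(s−1)) lim_r p^{−r}Σ_{m<p^r}⟨x+m⟩^{1−s}` (`Hurwitz.lean`) and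
`padicZetaValue` (`Basic.lean`):

* §1 `norm_inv_pow_one_add_sub_le` (`‖(1+u)^{−n} − 1 + nu‖ ≤ ‖u‖²`) and the uniform strict
  differentiability of `t ↦ (x+t)^{−n}` on `ℤ_p` for `|x|_p > 1` (`norm_taylor_inv_pow_add_le`);
* §2 `tendsto_riemannSum_inv_pow_one_sub`: the Riemann sums of `(1−x+m)^{−n}` tend to `(−1)ⁿ·∫(x+t)^{−n}dt`
  (Robert's `σ`-invariance);
* §3 `teichmullerUnit_neg` (`ω(−u) = −ω(u)`), `teichmuller_one_sub` (`ω(1−x) = −ω(x)` for `|x|_p ≥ q_p`);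
* §4 **`padicHurwitzZeta_one_sub`: `ζ_p(s, 1 − x) = ζ_p(s, x)`** for every prime `p`, `s ≥ 2`, `|x|_p ≥ q_p`
  [(2.1)];
* §5 `p = 3`: `padicZetaValue_three_eq_third_add_two_thirds` (Lemma 2.7, first display at `p = 3`),
  `padicHurwitzZeta_three_two_thirds_eq_third`, **`padicZetaValue_three_eq`: `ζ₃(j) = ⅔ ζ₃(j, ⅓)`** (Lemma 2.7,
  second display at `p = 3`), `calegari2005_theorem34_iff` (`ζ₃(3) ∉ ℚ ⟺ ζ₃(3,⅓) ∉ ℚ`), and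
  **`beukers2008_prop10_three`: `Σ_{n≥0}(n+1)B_n(−3)^{n+2} = 27·ζ₃(3)`** with
  `tendsto_riemannSum_third` (`T₃(⅓) = ∫_{ℤ₃}(⅓+t)^{−2}dt`);
* §6 every prime `p`: `teichmuller_natCast_qp_sub` (`ω(q_p − a) = −ω(a)`), `padicHurwitzZeta_qp_sub_div`
  (`ζ_p(j,(q_p−a)/q_p) = ζ_p(j,a/q_p)`) and **`padicZetaValue_eq_two_div_qp_mul_sum`: Lemma 2.7, second display,
  `ζ_p(j) = (2/q_p) Σ_{0<a<q_p/2, p∤a} ω(a)^{1−j} ζ_p(j, a/q_p)`** (odd `j ≥ 3`).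

Cell zeta5-irr / pub-zeta5 (HONEST FRAMING: systematic search; no irrationality claim unless kernel-certified):
`p`-adic bookkeeping for the record `calegari2005_theorem34` (`ζ₃(3) ∉ ℚ`, NOT proved here); nothing here bears
on `ζ(5) ∈ ℝ`.
-/

noncomputable section

open Filter Finset
open scoped Topology
open Literature.NumberTheory.LocalFields

namespace Literature.NumberTheory.Irrationality.PAdicZetaValues

variable {p : ℕ} [hp : Fact p.Prime]

/-! ## §1. Strict differentiability of `t ↦ (x + t)^{−n}` on `ℤ_p` (`|x|_p > 1`) -/

/-- `‖(1+u)^{−n} − 1 + n·u‖ ≤ ‖u‖²` for `‖u‖ < 1` (second-order binomial estimate; induction on `n` via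
`(1+u)^{−(n+1)} − 1 + (n+1)u = (1+u)^{−1}[(1+u)^{−n} − 1 + nu] + (1+u)^{−1}(n+1)u²`). [folklore] -/
private theorem norm_inv_pow_one_add_sub_le {u : ℚ_[p]} (hu : ‖u‖ < 1) (n : ℕ) :
    ‖((1 + u) ^ n)⁻¹ - 1 + (n : ℚ_[p]) * u‖ ≤ ‖u‖ ^ 2 := by
  have h1u : ‖(1 : ℚ_[p]) + u‖ = 1 := by
    have hne : ‖(1 : ℚ_[p])‖ ≠ ‖u‖ := by rw [norm_one]; exact hu.ne'
    rw [Padic.add_eq_max_of_ne hne, norm_one, max_eq_left hu.le]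
  have h0 : (1 : ℚ_[p]) + u ≠ 0 := by
    rw [← norm_ne_zero_iff, h1u]; exact one_ne_zero
  have hinv : ‖((1 : ℚ_[p]) + u)⁻¹‖ = 1 := by rw [norm_inv, h1u, inv_one]
  induction n with
  | zero => simp
  | succ n ih =>
    have key : ((1 + u) ^ (n + 1))⁻¹ - 1 + ((n + 1 : ℕ) : ℚ_[p]) * u =
        (1 + u)⁻¹ * (((1 + u) ^ n)⁻¹ - 1 + (n : ℚ_[p]) * u) + (1 + u)⁻¹ * (((n : ℚ_[p]) + 1) * u ^ 2) := by
      push_cast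
      field_simp
      ring
    rw [key]
    refine (Padic.nonarchimedean _ _).trans (max_le ?_ ?_)
    · rw [norm_mul, hinv, one_mul]; exact ih
    · rw [norm_mul, hinv, one_mul, norm_mul, norm_pow]
      have hn : ‖((n : ℚ_[p]) + 1)‖ ≤ 1 := by
        have := Padic.norm_int_le_one (p := p) ((n : ℤ) + 1)
        push_cast at this
        exact this
      calc ‖((n : ℚ_[p]) + 1)‖ * ‖u‖ ^ 2 ≤ 1 * ‖u‖ ^ 2 := by gcongr
        _ = ‖u‖ ^ 2 := one_mul _

/-- For `|x|_p > 1` and `t ∈ ℤ_p`: `|x + t|_p = |x|_p`. [folklore] -/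
private theorem norm_add_coe_eq {x : ℚ_[p]} (hx : 1 < ‖x‖) (t : ℤ_[p]) : ‖x + (t : ℚ_[p])‖ = ‖x‖ := by
  have ht : ‖(t : ℚ_[p])‖ < ‖x‖ := (PadicInt.norm_le_one t).trans_lt hx
  rw [Padic.add_eq_max_of_ne ht.ne', max_eq_left ht.le]

/-- For `|x|_p > 1` and `t ∈ ℤ_p`: `x + t ≠ 0`. [folklore] -/
private theorem add_coe_ne_zero {x : ℚ_[p]} (hx : 1 < ‖x‖) (t : ℤ_[p]) : x + (t : ℚ_[p]) ≠ 0 := by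
  rw [← norm_ne_zero_iff, norm_add_coe_eq hx t]; exact (zero_lt_one.trans hx).ne'

/-- **Second-order Taylor estimate** for `f(t) = (x+t)^{−n}` on `ℤ_p` (`|x|_p > 1`):
`‖f(y) − f(t₀) − (y − t₀)·f′(t₀)‖ ≤ ‖y − t₀‖²` with `f′(t) = −n(x+t)^{−(n+1)}` — i.e. `f ∈ S¹(ℤ_p)` in Robert's
uniform form. [cite: Robert2000PadicAnalysis, Ch. V §1.1 Proposition 2 (iii) (strict differentiability)] -/
theorem norm_taylor_inv_pow_add_le {x : ℚ_[p]} (hx : 1 < ‖x‖) (n : ℕ) (t₀ y : ℤ_[p]) :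
    ‖((x + (y : ℚ_[p])) ^ n)⁻¹ - ((x + (t₀ : ℚ_[p])) ^ n)⁻¹ -
        ((y - t₀ : ℤ_[p]) : ℚ_[p]) * (-(n : ℚ_[p]) * ((x + (t₀ : ℚ_[p])) ^ (n + 1))⁻¹)‖ ≤
      ‖((y - t₀ : ℤ_[p]) : ℚ_[p])‖ ^ 2 := by
  set a : ℚ_[p] := x + (t₀ : ℚ_[p]) with ha
  set h : ℚ_[p] := ((y - t₀ : ℤ_[p]) : ℚ_[p]) with hh
  have ha0 : a ≠ 0 := add_coe_ne_zero hx t₀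
  have hna : ‖a‖ = ‖x‖ := norm_add_coe_eq hx t₀
  set u : ℚ_[p] := h * a⁻¹ with hu
  have hh1 : ‖h‖ ≤ 1 := by rw [hh]; exact PadicInt.norm_le_one _
  have hun : ‖u‖ ≤ ‖h‖ := by
    rw [hu, norm_mul, norm_inv, hna]
    calc ‖h‖ * ‖x‖⁻¹ ≤ ‖h‖ * 1 := by gcongr; exact inv_le_one_of_one_le₀ hx.le
      _ = ‖h‖ := mul_one _
  have hu1 : ‖u‖ < 1 := by
    rw [hu, norm_mul, norm_inv, hna]
    calc ‖h‖ * ‖x‖⁻¹ ≤ 1 * ‖x‖⁻¹ := by gcongr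
      _ < 1 := by rw [one_mul]; exact inv_lt_one_of_one_lt₀ hx
  have hxy : x + (y : ℚ_[p]) = a * (1 + u) := by
    have : x + (y : ℚ_[p]) = a + h := by rw [ha, hh]; push_cast; ring
    rw [this, hu]; field_simp
  have key : ((x + (y : ℚ_[p])) ^ n)⁻¹ - (a ^ n)⁻¹ - h * (-(n : ℚ_[p]) * (a ^ (n + 1))⁻¹) =
      (a ^ n)⁻¹ * (((1 + u) ^ n)⁻¹ - 1 + (n : ℚ_[p]) * u) := by
    rw [hxy, mul_pow, mul_inv, hu, pow_succ, mul_inv]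
    ring
  rw [key, norm_mul, norm_inv, norm_pow, hna]
  have hxn : (‖x‖ ^ n)⁻¹ ≤ 1 := inv_le_one_of_one_le₀ (one_le_pow₀ hx.le)
  calc (‖x‖ ^ n)⁻¹ * ‖((1 + u) ^ n)⁻¹ - 1 + (n : ℚ_[p]) * u‖ ≤ 1 * ‖u‖ ^ 2 :=
        mul_le_mul hxn (norm_inv_pow_one_add_sub_le hu1 n) (norm_nonneg _) zero_le_one
    _ ≤ ‖h‖ ^ 2 := by rw [one_mul]; gcongr

/-- The uniform `S¹` form required by Robert's Proposition 4 for `f(t) = (x+t)^{−n}`: for every `ε > 0`,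
`‖f(y) − f(t₀) − (y−t₀)f′(t₀)‖ ≤ ε‖y − t₀‖` once `‖y − t₀‖ < ε`. [cite: Robert2000PadicAnalysis, Ch. V §1.1 Definition (`S¹(ℤ_p)`)] -/
theorem strictDiff_inv_pow_add {x : ℚ_[p]} (hx : 1 < ‖x‖) (n : ℕ) :
    ∀ ε > 0, ∃ δ > 0, ∀ t₀ y : ℤ_[p], ‖y - t₀‖ < δ →
      ‖((x + (y : ℚ_[p])) ^ n)⁻¹ - ((x + (t₀ : ℚ_[p])) ^ n)⁻¹ -
          ((y - t₀ : ℤ_[p]) : ℚ_[p]) • (-(n : ℚ_[p]) * ((x + (t₀ : ℚ_[p])) ^ (n + 1))⁻¹)‖ ≤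
        ε * ‖y - t₀‖ := by
  intro ε hε
  refine ⟨ε, hε, fun t₀ y hy => ?_⟩
  rw [smul_eq_mul]
  refine (norm_taylor_inv_pow_add_le hx n t₀ y).trans ?_
  rw [PadicInt.padic_norm_e_of_padicInt, sq]
  exact mul_le_mul_of_nonneg_right hy.le (norm_nonneg _)

/-- The derivative `t ↦ −n(x+t)^{−(n+1)}` is continuous on `ℤ_p` (`x + t ≠ 0`). [folklore] -/
private theorem continuous_deriv_inv_pow_add {x : ℚ_[p]} (hx : 1 < ‖x‖) (n : ℕ) :
    Continuous fun t : ℤ_[p] => -(n : ℚ_[p]) * ((x + (t : ℚ_[p])) ^ (n + 1))⁻¹ := by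
  exact continuous_const.mul
    (((continuous_const.add continuous_subtype_val).pow _).inv₀ fun t => pow_ne_zero _ (add_coe_ne_zero hx t))

/-! ## §2. Reflecting the Riemann sums: `∫(1−x+t)^{−n}dt = (−1)ⁿ∫(x+t)^{−n}dt` -/

/-- The Riemann sums `p^{−r}Σ_{m<p^r}(x+m)^{−n}` are the tree's `volkenbornSum` of `t ↦ (x+t)^{−n}`.
[cite: Robert2000PadicAnalysis, Ch. V §5.1 (Riemann sums)] -/
theorem volkenbornSum_inv_pow_add (x : ℚ_[p]) (n r : ℕ) :
    volkenbornSum p (fun t : ℤ_[p] => ((x + (t : ℚ_[p])) ^ n)⁻¹) r =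
      (p : ℚ_[p]) ^ (-(r : ℤ)) * ∑ m ∈ range (p ^ r), ((x + (m : ℚ_[p])) ^ n)⁻¹ := by
  rw [volkenbornSum_def, smul_eq_mul, zpow_neg, zpow_natCast]
  simp only [PadicInt.coe_natCast]

/-- **Robert's `σ`-invariance applied to `(x+t)^{−n}`**: if `p^{−r}Σ_{m<p^r}(x+m)^{−n} → V` then
`p^{−r}Σ_{m<p^r}(1−x+m)^{−n} → (−1)ⁿV` (`1 − x + m = −(x + σ(m))`, `σ(t) = −1 − t`).
[cite: Robert2000PadicAnalysis, Ch. V §5.3 Proposition 4] [cite: Lai2025TwoAdicZeta, §2.3 (2.1) (proof ingredient)] -/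
theorem tendsto_riemannSum_inv_pow_one_sub {x : ℚ_[p]} (hx : 1 < ‖x‖) (n : ℕ) {V : ℚ_[p]}
    (hV : Tendsto (fun r : ℕ => (p : ℚ_[p]) ^ (-(r : ℤ)) * ∑ m ∈ range (p ^ r), ((x + (m : ℚ_[p])) ^ n)⁻¹)
      atTop (𝓝 V)) :
    Tendsto (fun r : ℕ => (p : ℚ_[p]) ^ (-(r : ℤ)) * ∑ m ∈ range (p ^ r), ((1 - x + (m : ℚ_[p])) ^ n)⁻¹)
      atTop (𝓝 ((-1) ^ n * V)) := by
  set f : ℤ_[p] → ℚ_[p] := fun t => ((x + (t : ℚ_[p])) ^ n)⁻¹ with hf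
  have hV' : Tendsto (volkenbornSum p f) atTop (𝓝 V) := by
    refine hV.congr fun r => ?_
    rw [hf, volkenbornSum_inv_pow_add]
  have hσ := tendsto_volkenbornSum_comp_sigma (p := p) (F := ℚ_[p])
    (continuous_deriv_inv_pow_add hx n) (strictDiff_inv_pow_add hx n) hV'
  have hσ' := hσ.const_mul ((-1 : ℚ_[p]) ^ n)
  refine hσ'.congr fun r => ?_
  rw [volkenbornSum_def, smul_eq_mul, zpow_neg, zpow_natCast, ← mul_assoc, mul_comm ((-1 : ℚ_[p]) ^ n),
    mul_assoc, mul_sum]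
  congr 1
  refine sum_congr rfl fun m _ => ?_
  simp only [PadicInt.coe_sub, PadicInt.coe_neg, PadicInt.coe_one, PadicInt.coe_natCast]
  have e : (1 - x + (m : ℚ_[p])) = (-1) * (x + (-1 - (m : ℚ_[p]))) := by ring
  rw [e, mul_pow, mul_inv, ← inv_pow (-1 : ℚ_[p]) n, inv_neg_one]

/-! ## §3. The Teichmüller character at `−u` and at `1 − x` -/

/-- Every `2`-adic unit is `≡ 1 (mod 2)`: `‖u − 1‖ ≤ ½` for `‖u‖ = 1` in `ℚ_2`. [folklore] -/
private theorem norm_sub_one_le_half {u : ℚ_[2]} (hu : ‖u‖ = 1) : ‖u - 1‖ ≤ 2⁻¹ := by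
  set z : ℤ_[2] := ⟨u, hu.le⟩ with hz
  obtain ⟨n, hn2, hn⟩ := PadicInt.exists_mem_range z
  have hlt : ‖z - n‖ < 1 := PadicInt.mem_nonunits.1 ((IsLocalRing.mem_maximalIdeal _).1 hn)
  interval_cases n
  · exfalso
    rw [Nat.cast_zero, sub_zero, PadicInt.norm_def] at hlt
    exact absurd hlt (by rw [show ((z : ℤ_[2]) : ℚ_[2]) = u from rfl, hu]; exact lt_irrefl _)
  · have h' : ‖u - 1‖ < 1 := by
      rw [PadicInt.norm_def] at hlt
      have e : ((z - (1 : ℕ) : ℤ_[2]) : ℚ_[2]) = u - 1 := by push_cast; rfl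
      rwa [e] at hlt
    have h2 := (Padic.norm_le_pow_iff_norm_lt_pow_add_one (u - 1) (-1)).2 (by norm_num; exact h')
    have e2 : (((2 : ℕ) : ℝ)) ^ (-1 : ℤ) = 2⁻¹ := by norm_num
    rwa [e2] at h2

/-- Every `2`-adic unit is `≡ ±1 (mod 4)`: for `‖u‖ = 1` in `ℚ_2`, `‖u − 1‖ < ½` or `‖u + 1‖ < ½`
(if `u − 1 = 2w` with `w` a unit, then `w ≡ 1 (mod 2)` and `u + 1 = 2(w + 1) ∈ 4ℤ_2`). [folklore] -/
private theorem norm_sub_one_lt_or_norm_add_one_lt {u : ℚ_[2]} (hu : ‖u‖ = 1) :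
    ‖u - 1‖ < 2⁻¹ ∨ ‖u + 1‖ < 2⁻¹ := by
  rcases (norm_sub_one_le_half hu).lt_or_eq with h | h
  · exact Or.inl h
  · right
    have h2 : ‖(2 : ℚ_[2])‖ = 2⁻¹ := by simpa using Padic.norm_p (p := 2)
    set w : ℚ_[2] := (u - 1) * 2⁻¹ with hw
    have hwn : ‖w‖ = 1 := by rw [hw, norm_mul, norm_inv, h, h2]; norm_num
    have hw1 := norm_sub_one_le_half hwn
    have e : u + 1 = 2 * ((w - 1) + 2) := by rw [hw]; ring
    rw [e, norm_mul, h2]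
    have : ‖(w - 1) + 2‖ ≤ 2⁻¹ := (Padic.nonarchimedean _ _).trans (max_le hw1 h2.le)
    calc (2 : ℝ)⁻¹ * ‖(w - 1) + 2‖ ≤ 2⁻¹ * 2⁻¹ := by gcongr
      _ < 2⁻¹ := by norm_num

/-- **`ω(−u) = −ω(u)`** for a `p`-adic unit `u` (`−1 ∈ μ_{φ(q_p)}(ℤ_p)`; for odd `p`, `(−u)^{p^k} = −u^{p^k}`;
for `p = 2`, `−u ≡ ∓1` when `u ≡ ±1 (mod 4)`). [cite: Lai2025TwoAdicZeta, §2.3 (the Teichmüller character `ω`)] -/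
theorem teichmullerUnit_neg {u : ℚ_[p]} (hu : ‖u‖ = 1) : teichmullerUnit p (-u) = -teichmullerUnit p u := by
  by_cases hp2 : p = 2
  · subst hp2
    rw [teichmullerUnit_two, teichmullerUnit_two]
    have hneg : ‖-u - 1‖ = ‖u + 1‖ := by rw [← norm_neg]; congr 1; ring
    have h2 : ‖(2 : ℚ_[2])‖ = 2⁻¹ := by exact_mod_cast Padic.norm_p (p := 2)
    have hnot : ¬ (‖u - 1‖ < 2⁻¹ ∧ ‖u + 1‖ < 2⁻¹) := by
      rintro ⟨h1, h3⟩
      have : ‖(u + 1) + (-(u - 1))‖ < 2⁻¹ :=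
        (Padic.nonarchimedean _ _).trans_lt (max_lt h3 (by rwa [norm_neg]))
      rw [show (u + 1) + (-(u - 1)) = (2 : ℚ_[2]) by ring, h2] at this
      exact lt_irrefl _ this
    rcases norm_sub_one_lt_or_norm_add_one_lt hu with h1 | h1
    · rw [if_pos h1, hneg, if_neg (fun h3 => hnot ⟨h1, h3⟩)]
    · rw [hneg, if_pos h1, if_neg (fun h3 => hnot ⟨h3, h1⟩), neg_neg]
  · have hu' : ‖-u‖ = 1 := by rw [norm_neg, hu]
    have h1 := tendsto_pow_teichmullerUnit hp2 hu'
    have h2 := (tendsto_pow_teichmullerUnit hp2 hu).neg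
    have hodd : ∀ k : ℕ, Odd (p ^ k) := fun k => (hp.out.odd_of_ne_two hp2).pow
    have h3 : (fun k : ℕ => (-u) ^ p ^ k) = fun k => -(u ^ p ^ k) := funext fun k => (hodd k).neg_pow u
    rw [h3] at h1
    exact tendsto_nhds_unique h1 h2

/-- `‖x‖ = p^{−v}` determines the valuation `v`. [folklore] -/
private theorem valuation_eq_of_norm_eq {x : ℚ_[p]} (hx0 : x ≠ 0) {v : ℤ} (h : ‖x‖ = (p : ℝ) ^ (-v)) :
    x.valuation = v := by
  rw [Padic.norm_eq_zpow_neg_valuation hx0] at h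
  have hp1 : (1 : ℝ) < p := by exact_mod_cast hp.out.one_lt
  have := zpow_right_injective₀ (by positivity) hp1.ne' h
  omega

/-- `|x·p^{−v_p(x)}|_p = 1`: the unit part of `x ≠ 0`. [folklore] -/
private theorem norm_unitPart {x : ℚ_[p]} (hx0 : x ≠ 0) : ‖x * (p : ℚ_[p]) ^ (-x.valuation)‖ = 1 := by
  rw [norm_mul, Padic.norm_p_zpow, neg_neg, Padic.norm_eq_zpow_neg_valuation hx0,
    ← zpow_add₀ (by exact_mod_cast hp.out.ne_zero : (p : ℝ) ≠ 0), neg_add_cancel, zpow_zero]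

/-- For `|x|_p > 1`: `|1 − x|_p = |x|_p`. [folklore] -/
private theorem norm_one_sub_eq {x : ℚ_[p]} (hx : 1 < ‖x‖) : ‖1 - x‖ = ‖x‖ := by
  have hne : ‖(1 : ℚ_[p])‖ ≠ ‖-x‖ := by rw [norm_one, norm_neg]; exact hx.ne
  rw [sub_eq_add_neg, Padic.add_eq_max_of_ne hne, norm_neg, norm_one, max_eq_right hx.le]

/-- **`ω(1 − x) = −ω(x)` for `|x|_p ≥ q_p`**: `1 − x` and `x` have the same valuation, and unit parts
`−u + p^{−v}` and `−u` congruent modulo `q_p` (`|p^{−v}|_p = |x|_p⁻¹ ≤ q_p⁻¹`); then `ω(−u) = −ω(u)`.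
[cite: Lai2025TwoAdicZeta, §2.3 (`ω(x) := p^{v_p(x)}ω(x/p^{v_p(x)})`, proof ingredient of (2.1))] -/
theorem teichmuller_one_sub {x : ℚ_[p]} (hx : ((qp p : ℕ) : ℝ) ≤ ‖x‖) :
    teichmuller p (1 - x) = -teichmuller p x := by
  have hx1 : 1 < ‖x‖ := one_lt_norm_of_qp_le hx
  have hx0 : x ≠ 0 := by rw [← norm_ne_zero_iff]; exact (zero_lt_one.trans hx1).ne'
  have hn1x : ‖1 - x‖ = ‖x‖ := norm_one_sub_eq hx1
  have h1x0 : 1 - x ≠ 0 := by rw [← norm_ne_zero_iff, hn1x]; exact (zero_lt_one.trans hx1).ne'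
  have hval : (1 - x).valuation = x.valuation :=
    valuation_eq_of_norm_eq h1x0 (by rw [hn1x, Padic.norm_eq_zpow_neg_valuation hx0])
  have hp0 : (p : ℚ_[p]) ≠ 0 := by exact_mod_cast hp.out.ne_zero
  set v : ℤ := x.valuation with hv
  have hu : ‖x * (p : ℚ_[p]) ^ (-v)‖ = 1 := norm_unitPart hx0
  have hu' : ‖-(x * (p : ℚ_[p]) ^ (-v))‖ = 1 := by rw [norm_neg, hu]
  have hu1 : ‖(1 - x) * (p : ℚ_[p]) ^ (-v)‖ = 1 := by
    have := norm_unitPart h1x0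
    rwa [hval] at this
  have hpv : ‖(p : ℚ_[p]) ^ (-v)‖ ≤ ((qp p : ℕ) : ℝ)⁻¹ := by
    rw [Padic.norm_p_zpow, neg_neg]
    have e : (p : ℝ) ^ v = ‖x‖⁻¹ := by rw [Padic.norm_eq_zpow_neg_valuation hx0, zpow_neg, inv_inv]
    rw [e]
    have hq0 : (0 : ℝ) < ((qp p : ℕ) : ℝ) := by have := one_lt_qp (p := p); positivity
    exact inv_anti₀ hq0 hx
  unfold teichmuller
  rw [hval, ← hv]
  have e1 : (1 - x) * (p : ℚ_[p]) ^ (-v) = -(x * (p : ℚ_[p]) ^ (-v)) + (p : ℚ_[p]) ^ (-v) := by ring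
  have hcongr : teichmullerUnit p ((1 - x) * (p : ℚ_[p]) ^ (-v)) = teichmullerUnit p (-(x * (p : ℚ_[p]) ^ (-v))) := by
    refine teichmullerUnit_congr hu1 hu' ?_
    rw [e1, add_sub_cancel_left]
    exact hpv
  rw [hcongr, teichmullerUnit_neg hu, mul_neg]

/-! ## §4. The reflection formula (2.1) -/

/-- For `|x|_p ≥ q_p` also `|1 − x|_p ≥ q_p`. [cite: Lai2025TwoAdicZeta, §2.3 (domain `|x|_p ≥ q_p` of `ζ_p(s,·)`)] -/
theorem qp_le_norm_one_sub {x : ℚ_[p]} (hx : ((qp p : ℕ) : ℝ) ≤ ‖x‖) : ((qp p : ℕ) : ℝ) ≤ ‖1 - x‖ := by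
  rw [norm_one_sub_eq (one_lt_norm_of_qp_le hx)]; exact hx

/-- **The reflection formula `ζ_p(s, 1 − x) = ζ_p(s, x)`** for every prime `p`, every integer `s ≥ 2` and every
`x ∈ ℚ_p` with `|x|_p ≥ q_p`, for the TREE's `padicHurwitzZeta` (Volkenborn form of [Lai2025TwoAdicZeta, §2.3]):
by Sprang's Lemma 3.1 (`ω(x)^{1−s}ζ_p(s,x) = (1/(s−1))∫(x+t)^{1−s}dt`, tree `sprang2020_lemma31_holds`), Robert's
`σ`-invariance (`∫(1−x+t)^{1−s}dt = (−1)^{s−1}∫(x+t)^{1−s}dt`) and `ω(1−x)^{1−s} = (−1)^{1−s}ω(x)^{1−s}`.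
[cite: Lai2025TwoAdicZeta, §2.3 (2.1) ("the reflection formula [Coh07]")] [cite: Cohen2007NumberTheoryII, §11.2 (p-adic Hurwitz zeta functions)] -/
theorem padicHurwitzZeta_one_sub {s : ℕ} (hs : 2 ≤ s) {x : ℚ_[p]} (hx : ((qp p : ℕ) : ℝ) ≤ ‖x‖) :
    padicHurwitzZeta p s (1 - x) = padicHurwitzZeta p s x := by
  have hx1 : 1 < ‖x‖ := one_lt_norm_of_qp_le hx
  have hx0 : x ≠ 0 := by rw [← norm_ne_zero_iff]; exact (zero_lt_one.trans hx1).ne'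
  have hx' := qp_le_norm_one_sub hx
  obtain ⟨V, hV, hVeq⟩ := sprang2020_lemma31_holds p s x (by omega) hx
  obtain ⟨V', hV', hV'eq⟩ := sprang2020_lemma31_holds p s (1 - x) (by omega) hx'
  -- the exponent `1 − s = −(s − 1)`
  obtain ⟨n, rfl⟩ : ∃ n : ℕ, s = n + 1 := ⟨s - 1, by omega⟩
  have hexp : ∀ y : ℚ_[p], y ^ (1 - ((n + 1 : ℕ) : ℤ)) = (y ^ n)⁻¹ := fun y => by
    rw [show (1 - ((n + 1 : ℕ) : ℤ)) = -(n : ℤ) by push_cast; ring, zpow_neg, zpow_natCast]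
  simp only [hexp] at hV hV'
  have hV2 := tendsto_riemannSum_inv_pow_one_sub hx1 n hV
  have hVV : V' = (-1) ^ n * V := tendsto_nhds_unique hV' hV2
  have hω := teichmuller_one_sub hx
  have hω0 : teichmuller p x ≠ 0 := teichmuller_ne_zero hx0
  have hωs : teichmuller p x ^ (1 - ((n + 1 : ℕ) : ℤ)) ≠ 0 := zpow_ne_zero _ hω0
  rw [hω, hVV] at hV'eq
  -- parity of `n = s − 1`
  have key : teichmuller p x ^ (1 - ((n + 1 : ℕ) : ℤ)) * padicHurwitzZeta p (n + 1) (1 - x) =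
      1 / (((n + 1 : ℕ) : ℚ_[p]) - 1) * V := by
    rcases Nat.even_or_odd n with hn | hn
    · have h1 : Even (1 - ((n + 1 : ℕ) : ℤ)) := by
        obtain ⟨k, hk⟩ := hn
        exact ⟨-(k : ℤ), by rw [hk]; push_cast; ring⟩
      rw [h1.neg_zpow, hn.neg_one_pow] at hV'eq
      linear_combination hV'eq
    · have h1 : Odd (1 - ((n + 1 : ℕ) : ℤ)) := by
        obtain ⟨k, hk⟩ := hn
        exact ⟨-(k : ℤ) - 1, by rw [hk]; push_cast; ring⟩
      rw [h1.neg_zpow, hn.neg_one_pow] at hV'eq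
      linear_combination (-1 : ℚ_[p]) * hV'eq
  rw [← hVeq] at key
  exact mul_left_cancel₀ hωs key

/-! ## §5. `p = 3`: Lemma 2.7 at `p = 3`, `ζ₃(j) = ⅔ ζ₃(j, ⅓)`, and Beukers' `T₃(⅓) = 3³ζ₃(3)` -/

/-- `q_3 = 3`. [cite: Lai2025TwoAdicZeta, §2.3 (`q_p = p` for odd `p`)] -/
theorem qp_three : qp 3 = 3 := by rw [qp, if_neg (by decide)]

/-- `‖3‖_3 = ⅓`. [folklore] -/
private theorem norm_three : ‖(3 : ℚ_[3])‖ = 3⁻¹ := by simpa using Padic.norm_p (p := 3)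

/-- `ω(1) = 1` in `ℤ_3` (`1^{3^k} = 1`). [cite: Lai2025TwoAdicZeta, §2.3 (the Teichmüller character)] -/
private theorem teichmullerUnit_three_one : teichmullerUnit 3 (1 : ℚ_[3]) = 1 := by
  have h := tendsto_pow_teichmullerUnit (p := 3) (by decide) (u := 1) (by simp)
  simp only [one_pow] at h
  exact tendsto_nhds_unique h tendsto_const_nhds

/-- `ω(1) = 1` for the unit class `a = 1` modulo `q_3 = 3`. [cite: Lai2025TwoAdicZeta, Lemma 2.7 (§2.3) at `p = 3`] -/
theorem teichmuller_three_one : teichmuller 3 ((1 : ℕ) : ℚ_[3]) = 1 := by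
  rw [Nat.cast_one, teichmuller, Padic.valuation_one, neg_zero, zpow_zero, one_mul, mul_one,
    teichmullerUnit_three_one]

/-- `ω(2) = −1` in `ℤ_3` for the unit class `a = 2` modulo `q_3 = 3` (`2 ≡ −1 (mod 3)` and `ω(−1) = −1`).
[cite: Lai2025TwoAdicZeta, Lemma 2.7 (§2.3) at `p = 3`] -/
theorem teichmuller_three_two : teichmuller 3 ((2 : ℕ) : ℚ_[3]) = -1 := by
  have hn : ‖((2 : ℕ) : ℚ_[3])‖ = 1 := Padic.norm_natCast_eq_one_iff.2 (by decide)
  have h0 : ((2 : ℕ) : ℚ_[3]) ≠ 0 := by rw [← norm_ne_zero_iff, hn]; exact one_ne_zero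
  have hval : (((2 : ℕ) : ℚ_[3])).valuation = 0 :=
    valuation_eq_of_norm_eq h0 (by rw [hn, neg_zero, zpow_zero])
  rw [teichmuller, hval, neg_zero, zpow_zero, one_mul, mul_one]
  have hc : teichmullerUnit 3 ((2 : ℕ) : ℚ_[3]) = teichmullerUnit 3 (-1) := by
    refine teichmullerUnit_congr hn (by simp) ?_
    rw [show ((2 : ℕ) : ℚ_[3]) - -1 = 3 by norm_num, norm_three, qp_three]
    norm_num
  rw [hc, teichmullerUnit_neg (by simp), teichmullerUnit_three_one]

/-- **Lemma 2.7, first display, at `p = 3` (odd `j ≥ 3`):** `ζ₃(j) = ⅓(ζ₃(j, ⅓) + ζ₃(j, ⅔))` (`q_3 = 3`, unit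
classes `a = 1, 2`, `ω(1)^{1−j} = ω(2)^{1−j} = 1` as `1 − j` is even) — the instance of `lai2025TwoAdic_lemma27_holds`.
[cite: Lai2025TwoAdicZeta, Lemma 2.7 (§2.3), first display at `p = 3`] -/
theorem padicZetaValue_three_eq_third_add_two_thirds {j : ℕ} (hj : Odd j) (hj3 : 3 ≤ j) :
    padicZetaValue 3 j = (1 / 3 : ℚ_[3]) *
      (padicHurwitzZeta 3 j ((1 : ℚ_[3]) / 3) + padicHurwitzZeta 3 j ((2 : ℚ_[3]) / 3)) := by
  have h := lai2025TwoAdic_lemma27_holds 3 j hj hj3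
  rw [qp_three, show (Finset.range 3).filter (fun a => ¬ 3 ∣ a) = {1, 2} by decide,
    Finset.sum_pair (by norm_num), teichmuller_three_one, teichmuller_three_two, one_zpow] at h
  have heven : Even (1 - (j : ℤ)) := by
    obtain ⟨k, rfl⟩ := hj
    exact ⟨-(k : ℤ), by push_cast; ring⟩
  rw [heven.neg_one_zpow] at h
  rw [h]
  push_cast
  ring

/-- `q_3 ≤ ‖⅓‖_3 = 3`. [cite: Lai2025TwoAdicZeta, §2.3 (`|x|_p ≥ q_p` at `x = ⅓`, `p = 3`)] -/
theorem qp_three_le_norm_third : ((qp 3 : ℕ) : ℝ) ≤ ‖(1 : ℚ_[3]) / 3‖ := by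
  rw [qp_three, norm_div, norm_one, norm_three]
  norm_num

/-- **The reflection at `p = 3`, `x = ⅓`: `ζ₃(s, ⅔) = ζ₃(s, ⅓)`** (`s ≥ 2`). [cite: Lai2025TwoAdicZeta, §2.3 (2.1) at `p = 3`, `x = ⅓`] [cite: Beukers2008, Corollary 8 ("T(x) = T(1−x)")] -/
theorem padicHurwitzZeta_three_two_thirds_eq_third {s : ℕ} (hs : 2 ≤ s) :
    padicHurwitzZeta 3 s ((2 : ℚ_[3]) / 3) = padicHurwitzZeta 3 s ((1 : ℚ_[3]) / 3) := by
  rw [show (2 : ℚ_[3]) / 3 = 1 - 1 / 3 by norm_num]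
  exact padicHurwitzZeta_one_sub hs qp_three_le_norm_third

/-- **Lemma 2.7, second display, at `p = 3`: `ζ₃(j) = ⅔ ζ₃(j, ⅓)`** for odd `j ≥ 3` («`ζ_p(j) = (2/q_p) Σ_{0<a<q_p/2}
ω(a)^{1−j} ζ_p(j, a/q_p)`» with the single class `a = 1`). [cite: Lai2025TwoAdicZeta, Lemma 2.7 (§2.3), second display at `p = 3`] -/
theorem padicZetaValue_three_eq {j : ℕ} (hj : Odd j) (hj3 : 3 ≤ j) :
    padicZetaValue 3 j = (2 / 3 : ℚ_[3]) * padicHurwitzZeta 3 j ((3 : ℚ_[3])⁻¹) := by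
  rw [padicZetaValue_three_eq_third_add_two_thirds hj hj3,
    padicHurwitzZeta_three_two_thirds_eq_third (by omega), one_div]
  ring

/-- **Calegari's Theorem 3.4 restated on the Hurwitz side**: `ζ₃(3) ∉ ℚ ⟺ ζ₃(3, ⅓) ∉ ℚ` (as `ζ₃(3) = ⅔ζ₃(3,⅓)`);
the right-hand side is Beukers' `T₃(⅓) ∉ ℚ` up to the factor `18` (`beukers2008_prop10_three`).  The named fact
`calegari2005_theorem34` itself is NOT proved here. [cite: Calegari2005, Thm 3.4] [cite: Beukers2008, Corollary 23 with Proposition 10] -/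
theorem calegari2005_theorem34_iff :
    calegari2005_theorem34 ↔ IsIrrational 3 (padicHurwitzZeta 3 3 ((3 : ℚ_[3])⁻¹)) := by
  unfold calegari2005_theorem34
  rw [padicZetaValue_three_eq (by decide) le_rfl, isIrrational_iff, isIrrational_iff]
  constructor
  · intro h q hq
    exact h ((2 / 3 : ℚ) * q) (by push_cast; rw [hq])
  · intro h q hq
    refine h ((3 / 2 : ℚ) * q) ?_
    push_cast
    rw [hq]
    ring

/-- `‖⅓‖_3 = 3 > 1`. [folklore] -/
private theorem one_lt_norm_inv_three : 1 < ‖(3 : ℚ_[3])⁻¹‖ := by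
  rw [norm_inv, norm_three, inv_inv]; norm_num

/-- **`ω(⅓) = ⅓`** in `ℚ_3` (valuation `−1`, unit part `1`). [cite: Lai2025TwoAdicZeta, §2.3 (`ω(x) := p^{v_p(x)}ω(x/p^{v_p(x)})`)] -/
theorem teichmuller_three_inv_three : teichmuller 3 ((3 : ℚ_[3])⁻¹) = (3 : ℚ_[3])⁻¹ := by
  have h3 : (3 : ℚ_[3]) ≠ 0 := by norm_num
  have hv : ((3 : ℚ_[3])⁻¹).valuation = -1 := by
    rw [Padic.valuation_inv, show (3 : ℚ_[3]) = ((3 : ℕ) : ℚ_[3]) by norm_num, Padic.valuation_p]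
  unfold teichmuller
  rw [hv, neg_neg, Nat.cast_ofNat, zpow_one, inv_mul_cancel₀ h3, teichmullerUnit_three_one, mul_one,
    zpow_neg, zpow_one]

/-- The coefficients `x^{−2}(n+1)(−x⁻¹)ⁿ → 0` for `|x|_p > 1` (`|x⁻¹|_p < 1`). [folklore] -/
private theorem tendsto_coeff_zero {q : ℕ} [Fact q.Prime] {x : ℚ_[q]} (hx : 1 < ‖x‖) (k : ℕ) :
    Tendsto (fun n : ℕ => (x ^ (k + 1))⁻¹ * (((n + k).choose k : ℕ) : ℚ_[q]) * (-x⁻¹) ^ n)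
      atTop (𝓝 0) := by
  refine squeeze_zero_norm (a := fun n => ‖(x ^ (k + 1))⁻¹‖ * ‖x⁻¹‖ ^ n) (fun n => ?_) ?_
  · rw [norm_mul, norm_mul, norm_pow, norm_neg]
    have h1 : ‖(((n + k).choose k : ℕ) : ℚ_[q])‖ ≤ 1 := by
      have := Padic.norm_int_le_one (p := q) (((n + k).choose k : ℕ) : ℤ)
      rwa [Int.cast_natCast] at this
    calc ‖(x ^ (k + 1))⁻¹‖ * ‖(((n + k).choose k : ℕ) : ℚ_[q])‖ * ‖x⁻¹‖ ^ n
        ≤ ‖(x ^ (k + 1))⁻¹‖ * 1 * ‖x⁻¹‖ ^ n := by gcongr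
      _ = ‖(x ^ (k + 1))⁻¹‖ * ‖x⁻¹‖ ^ n := by rw [mul_one]
  · have hlt : ‖x⁻¹‖ < 1 := by rw [norm_inv]; exact inv_lt_one_of_one_lt₀ hx
    have h := (tendsto_pow_atTop_nhds_zero_of_lt_one (norm_nonneg x⁻¹) hlt).const_mul ‖(x ^ (k + 1))⁻¹‖
    rwa [mul_zero] at h

/-- **Beukers 2008, Proposition 10 (`p = 3`): `T₃(⅓) = 3³ζ₃(3)`**, where `T(x) = Σ_{n≥0}(n+1)B_n(−1/x)^{n+2}` and
`T₃(⅓)` is the `3`-adic sum of this series at `x = ⅓` — here `ζ₃(3)` is the TREE's `padicZetaValue 3 3`.  Proof in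
the tree's language: the series is the term-by-term Volkenborn integral `∫_{ℤ₃}(⅓+t)^{−2}dt`
(`HurwitzVolkenbornProofs.tendsto_riemannSum_zpow_neg`), which is `2·ω(⅓)^{2}ζ₃(3,⅓) = 18ζ₃(3,⅓)` (Sprang's
Lemma 3.1) `= 27ζ₃(3)` (`padicZetaValue_three_eq`). [cite: Beukers2008, Proposition 10 (second item) with §1 (definition of T) and §5 (definition of T_p(a/F))] -/
theorem beukers2008_prop10_three :
    HasSum (fun n : ℕ => ((n : ℚ_[3]) + 1) * ((bernoulli n : ℚ) : ℚ_[3]) * (-3 : ℚ_[3]) ^ (n + 2))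
      (27 * padicZetaValue 3 3) := by
  set x : ℚ_[3] := (3 : ℚ_[3])⁻¹ with hxdef
  have hx : 1 < ‖x‖ := one_lt_norm_inv_three
  have hx3 : ((qp 3 : ℕ) : ℝ) ≤ ‖x‖ := by
    rw [hxdef, ← one_div]; exact qp_three_le_norm_third
  -- the Volkenborn integral `∫(⅓+t)^{−2}dt` as a Bernoulli series (tree)
  have hS := tendsto_riemannSum_zpow_neg (p := 3) hx 1
  -- Sprang's Lemma 3.1 at `s = 3`, `x = ⅓`
  obtain ⟨V, hV, hVeq⟩ := sprang2020_lemma31_holds 3 3 x (by norm_num) hx3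
  have e1 : (1 - ((3 : ℕ) : ℤ)) = -2 := by norm_num
  have e1' : (-(((1 : ℕ) : ℤ) + 1)) = -2 := by norm_num
  rw [e1] at hV
  rw [e1'] at hS
  have hVS := tendsto_nhds_unique hV hS
  -- `ω(⅓)^{−2} = 9`, so `V = 18 ζ₃(3,⅓) = 27 ζ₃(3)`
  rw [hxdef, teichmuller_three_inv_three] at hVeq
  have hζ := padicZetaValue_three_eq (j := 3) (by decide) le_rfl
  have hV27 : V = 27 * padicZetaValue 3 3 := by
    rw [hζ]
    have e2 : ((3 : ℚ_[3])⁻¹) ^ (1 - ((3 : ℕ) : ℤ)) = 9 := by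
      rw [e1, zpow_neg, inv_zpow, inv_inv]; norm_num
    rw [e2] at hVeq
    push_cast at hVeq
    linear_combination (-2 : ℚ_[3]) * hVeq
  -- the tree's series is Beukers' series, term by term
  have hcoef := tendsto_coeff_zero (q := 3) hx 1
  have hsum : Summable fun n : ℕ => ((bernoulli n : ℚ) : ℚ_[3]) *
      ((x ^ (1 + 1))⁻¹ * (((n + 1).choose 1 : ℕ) : ℚ_[3]) * (-x⁻¹) ^ n) := by
    simpa only [smul_eq_mul] using summable_bernoulli_smul (p := 3) (F := ℚ_[3]) hcoef
  have hterm : (fun n : ℕ => ((n : ℚ_[3]) + 1) * ((bernoulli n : ℚ) : ℚ_[3]) * (-3 : ℚ_[3]) ^ (n + 2)) =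
      fun n : ℕ => ((bernoulli n : ℚ) : ℚ_[3]) *
        ((x ^ (1 + 1))⁻¹ * (((n + 1).choose 1 : ℕ) : ℚ_[3]) * (-x⁻¹) ^ n) := by
    funext n
    simp only [hxdef, inv_pow, inv_inv, Nat.choose_one_right, Nat.cast_add, Nat.cast_one]
    ring
  rw [hterm, ← hV27, hVS]
  exact hsum.hasSum

/-- **`T₃(⅓) = ∫_{ℤ₃}(⅓ + t)^{−2}dt = 27ζ₃(3)`** — the Volkenborn form of Beukers' Proposition 10: the Riemann sums
`3^{−r}Σ_{m<3^r}(⅓+m)^{−2}` converge to `27·padicZetaValue 3 3`. [cite: Beukers2008, Proposition 10 (second item) and §5 ("T_p(a/F) = 2F³ω(a)^{−2}H_p(3,a,F)")] [cite: Sprang2020, Lemma 3.1 (§3)] -/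
theorem tendsto_riemannSum_third :
    Tendsto (fun r : ℕ => ((3 : ℕ) : ℚ_[3]) ^ (-(r : ℤ)) *
        ∑ m ∈ range (3 ^ r), (((3 : ℚ_[3])⁻¹ + (m : ℚ_[3])) ^ 2)⁻¹) atTop (𝓝 (27 * padicZetaValue 3 3)) := by
  set x : ℚ_[3] := (3 : ℚ_[3])⁻¹ with hxdef
  have hx : 1 < ‖x‖ := one_lt_norm_inv_three
  have hx3 : ((qp 3 : ℕ) : ℝ) ≤ ‖x‖ := by
    rw [hxdef, ← one_div]; exact qp_three_le_norm_third
  obtain ⟨V, hV, hVeq⟩ := sprang2020_lemma31_holds 3 3 x (by norm_num) hx3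
  have e1 : (1 - ((3 : ℕ) : ℤ)) = -2 := by norm_num
  rw [e1] at hV
  rw [hxdef, teichmuller_three_inv_three] at hVeq
  have hζ := padicZetaValue_three_eq (j := 3) (by decide) le_rfl
  have hV27 : V = 27 * padicZetaValue 3 3 := by
    rw [hζ]
    have e2 : ((3 : ℚ_[3])⁻¹) ^ (1 - ((3 : ℕ) : ℤ)) = 9 := by
      rw [e1, zpow_neg, inv_zpow, inv_inv]; norm_num
    rw [e2] at hVeq
    push_cast at hVeq
    linear_combination (-2 : ℚ_[3]) * hVeq
  rw [← hV27]
  refine hV.congr fun r => ?_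
  congr 1
  refine sum_congr rfl fun m _ => ?_
  rw [zpow_neg, show (2 : ℤ) = ((2 : ℕ) : ℤ) by norm_num, zpow_natCast]

/-! ## §6. Lemma 2.7, second display, for every prime `p`:
`ζ_p(j) = (2/q_p) Σ_{0<a<q_p/2, p∤a} ω(a)^{1−j} ζ_p(j, a/q_p)` -/

/-- `p ∣ q_p`. [cite: Lai2025TwoAdicZeta, §2.3 (`q_p = p`, resp. `4`)] -/
theorem dvd_qp : p ∣ qp p := by
  by_cases hp2 : p = 2
  · subst hp2; rw [qp, if_pos rfl]; norm_num
  · rw [qp, if_neg hp2]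

/-- `‖q_p‖_p = q_p⁻¹` (`q_p = p`, resp. `4 = 2²`). [cite: Lai2025TwoAdicZeta, §2.3 (`q_p`)] -/
theorem norm_natCast_qp : ‖((qp p : ℕ) : ℚ_[p])‖ = (((qp p : ℕ) : ℝ))⁻¹ := by
  by_cases hp2 : p = 2
  · subst hp2
    rw [qp, if_pos rfl]
    have h2 : ‖(2 : ℚ_[2])‖ = 2⁻¹ := by simpa using Padic.norm_p (p := 2)
    rw [show ((4 : ℕ) : ℚ_[2]) = (2 : ℚ_[2]) ^ 2 by norm_num, norm_pow, h2]
    norm_num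
  · rw [qp, if_neg hp2, Padic.norm_p]

/-- `2a ≠ q_p` for `p ∤ a` (for odd `p`, `q_p = p` is odd; for `p = 2`, `a = 2` is excluded). [cite: Lai2025TwoAdicZeta, Lemma 2.7 (§2.3), second display (the range `0 < a < q_p/2`)] -/
theorem two_mul_ne_qp {a : ℕ} (ha : ¬ p ∣ a) : 2 * a ≠ qp p := by
  by_cases hp2 : p = 2
  · subst hp2; rw [qp, if_pos rfl]; omega
  · rw [qp, if_neg hp2]
    intro h
    have hodd : Odd p := hp.out.odd_of_ne_two hp2
    obtain ⟨k, hk⟩ := hodd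
    omega

/-- `p ∤ q_p − a` for `p ∤ a`, `a < q_p`. [cite: Lai2025TwoAdicZeta, Lemma 2.7 (§2.3) (the unit classes modulo `q_p`)] -/
theorem not_dvd_qp_sub {a : ℕ} (ha : ¬ p ∣ a) (haQ : a < qp p) : ¬ p ∣ qp p - a := by
  intro h
  have hQ' : p ∣ (qp p - a) + a := by rw [Nat.sub_add_cancel haQ.le]; exact dvd_qp
  exact ha ((Nat.dvd_add_right h).1 hQ')

/-- `ω(y) = ω_unit(y)` for `|y|_p = 1` (valuation `0`). [cite: Lai2025TwoAdicZeta, §2.3 (`ω` on units)] -/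
theorem teichmuller_of_norm_eq_one {y : ℚ_[p]} (hy : ‖y‖ = 1) : teichmuller p y = teichmullerUnit p y := by
  have hy0 : y ≠ 0 := by rw [← norm_ne_zero_iff, hy]; exact one_ne_zero
  have hv : y.valuation = 0 := valuation_eq_of_norm_eq hy0 (by rw [hy, neg_zero, zpow_zero])
  rw [teichmuller, hv, neg_zero, zpow_zero, one_mul, mul_one]

/-- **`ω(q_p − a) = −ω(a)`** for a unit class `a` (`q_p − a ≡ −a (mod q_p)` and `ω(−a) = −ω(a)`).
[cite: Lai2025TwoAdicZeta, Lemma 2.7 (§2.3), passage from the first to the second display] -/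
theorem teichmuller_natCast_qp_sub {a : ℕ} (ha : ¬ p ∣ a) (haQ : a < qp p) :
    teichmuller p ((qp p - a : ℕ) : ℚ_[p]) = -teichmuller p (a : ℚ_[p]) := by
  have hna : ‖(a : ℚ_[p])‖ = 1 := norm_natCast_of_not_dvd ha
  have hnQa : ‖((qp p - a : ℕ) : ℚ_[p])‖ = 1 := norm_natCast_of_not_dvd (not_dvd_qp_sub ha haQ)
  rw [teichmuller_of_norm_eq_one hnQa, teichmuller_of_norm_eq_one hna]
  have e : ((qp p - a : ℕ) : ℚ_[p]) = -(a : ℚ_[p]) + ((qp p : ℕ) : ℚ_[p]) := by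
    rw [Nat.cast_sub haQ.le]; ring
  have hna' : ‖-(a : ℚ_[p])‖ = 1 := by rw [norm_neg, hna]
  rw [e] at hnQa ⊢
  have hc : teichmullerUnit p (-(a : ℚ_[p]) + ((qp p : ℕ) : ℚ_[p])) = teichmullerUnit p (-(a : ℚ_[p])) := by
    refine teichmullerUnit_congr hnQa hna' ?_
    rw [show -(a : ℚ_[p]) + ((qp p : ℕ) : ℚ_[p]) - -(a : ℚ_[p]) = ((qp p : ℕ) : ℚ_[p]) by ring,
      norm_natCast_qp]
  rw [hc, teichmullerUnit_neg hna]

/-- `q_p ≤ ‖a/q_p‖_p` (`= q_p`) for a unit class `a`. [cite: Lai2025TwoAdicZeta, §2.3 (domain `|x|_p ≥ q_p` at `x = a/q_p`)] -/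
theorem qp_le_norm_natCast_div_qp {a : ℕ} (ha : ¬ p ∣ a) :
    ((qp p : ℕ) : ℝ) ≤ ‖(a : ℚ_[p]) / ((qp p : ℕ) : ℚ_[p])‖ := by
  rw [norm_div, norm_natCast_of_not_dvd ha, norm_natCast_qp, one_div, inv_inv]

/-- **`ζ_p(j, (q_p − a)/q_p) = ζ_p(j, a/q_p)`** — the reflection at `x = a/q_p`. [cite: Lai2025TwoAdicZeta, §2.3 (2.1) at `x = a/q_p`] -/
theorem padicHurwitzZeta_qp_sub_div {a : ℕ} (ha : ¬ p ∣ a) (haQ : a < qp p) {s : ℕ} (hs : 2 ≤ s) :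
    padicHurwitzZeta p s (((qp p - a : ℕ) : ℚ_[p]) / ((qp p : ℕ) : ℚ_[p])) =
      padicHurwitzZeta p s ((a : ℚ_[p]) / ((qp p : ℕ) : ℚ_[p])) := by
  have hQ0 : ((qp p : ℕ) : ℚ_[p]) ≠ 0 := by
    have := one_lt_qp (p := p)
    exact_mod_cast (show qp p ≠ 0 by omega)
  have e : ((qp p - a : ℕ) : ℚ_[p]) / ((qp p : ℕ) : ℚ_[p]) = 1 - (a : ℚ_[p]) / ((qp p : ℕ) : ℚ_[p]) := by
    rw [Nat.cast_sub haQ.le]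
    field_simp
  rw [e]
  exact padicHurwitzZeta_one_sub hs (qp_le_norm_natCast_div_qp ha)

/-- **Lai 2025, Lemma 2.7, second display, for every prime `p`:** for odd `j ≥ 3`,
`ζ_p(j) = (2/q_p) Σ_{0 < a < q_p/2, p ∤ a} ω(a)^{1−j} ζ_p(j, a/q_p)` — from the first display (tree
`lai2025TwoAdic_lemma27_holds`) by pairing `a ↔ q_p − a`: `ω(q_p − a)^{1−j} = ω(a)^{1−j}` (`1 − j` even) and
`ζ_p(j, 1 − a/q_p) = ζ_p(j, a/q_p)` (the reflection formula). [cite: Lai2025TwoAdicZeta, Lemma 2.7 (§2.3), second display] -/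
theorem padicZetaValue_eq_two_div_qp_mul_sum {j : ℕ} (hj : Odd j) (hj3 : 3 ≤ j) :
    padicZetaValue p j = (2 / (qp p : ℚ_[p])) *
      ∑ a ∈ (Finset.range (qp p)).filter (fun a => ¬ p ∣ a ∧ 2 * a < qp p),
        teichmuller p (a : ℚ_[p]) ^ (1 - (j : ℤ)) * padicHurwitzZeta p j ((a : ℚ_[p]) / (qp p : ℚ_[p])) := by
  rw [lai2025TwoAdic_lemma27_holds p j hj hj3]
  set Q : ℕ := qp p with hQ
  set g : ℕ → ℚ_[p] := fun a => teichmuller p (a : ℚ_[p]) ^ (1 - (j : ℤ)) *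
    padicHurwitzZeta p j ((a : ℚ_[p]) / (Q : ℚ_[p])) with hg
  set S : Finset ℕ := (Finset.range Q).filter (fun a => ¬ p ∣ a) with hS
  have heven : Even (1 - (j : ℤ)) := by
    obtain ⟨k, rfl⟩ := hj
    exact ⟨-(k : ℤ), by push_cast; ring⟩
  -- the symmetry `g(q_p − a) = g(a)` on the unit classes
  have hsymm : ∀ a : ℕ, ¬ p ∣ a → a < Q → g (Q - a) = g a := by
    intro a ha haQ
    simp only [hg]
    rw [teichmuller_natCast_qp_sub ha haQ, heven.neg_zpow, padicHurwitzZeta_qp_sub_div ha haQ (by omega)]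
  have hsplit : (Finset.range Q).filter (fun a => ¬ p ∣ a ∧ 2 * a < Q) = S.filter (fun a => 2 * a < Q) := by
    rw [hS, Finset.filter_filter]
  have hsum : ∑ a ∈ S, g a =
      ∑ a ∈ S.filter (fun a => 2 * a < Q), g a + ∑ a ∈ S.filter (fun a => ¬ 2 * a < Q), g a :=
    (Finset.sum_filter_add_sum_filter_not S _ g).symm
  have hmem : ∀ {a : ℕ} {P : ℕ → Prop} [DecidablePred P], a ∈ S.filter P ↔ (a < Q ∧ ¬ p ∣ a) ∧ P a := by
    intro a P _
    rw [hS, Finset.mem_filter, Finset.mem_filter, Finset.mem_range]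
  have hpos : ∀ {a : ℕ}, ¬ p ∣ a → 0 < a := fun {a} ha => Nat.pos_of_ne_zero fun h => ha (h ▸ dvd_zero p)
  have hbij : ∑ a ∈ S.filter (fun a => ¬ 2 * a < Q), g a = ∑ a ∈ S.filter (fun a => 2 * a < Q), g a := by
    refine Finset.sum_nbij' (fun a => Q - a) (fun a => Q - a) ?_ ?_ ?_ ?_ ?_
    · intro a ha
      rw [hmem] at ha ⊢
      have h2 := two_mul_ne_qp (p := p) ha.1.2
      have h0 := hpos ha.1.2
      exact ⟨⟨by omega, not_dvd_qp_sub ha.1.2 ha.1.1⟩, by omega⟩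
    · intro a ha
      rw [hmem] at ha ⊢
      have h0 := hpos ha.1.2
      exact ⟨⟨by omega, not_dvd_qp_sub ha.1.2 ha.1.1⟩, by omega⟩
    · intro a ha
      rw [hmem] at ha
      show Q - (Q - a) = a
      omega
    · intro a ha
      rw [hmem] at ha
      show Q - (Q - a) = a
      omega
    · intro a ha
      rw [hmem] at ha
      exact (hsymm a ha.1.2 ha.1.1).symm
  rw [hsplit, hsum, hbij, ← two_mul]
  have hQ0 : (Q : ℚ_[p]) ≠ 0 := by
    have := one_lt_qp (p := p)
    exact_mod_cast (show Q ≠ 0 by omega)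
  field_simp

end Literature.NumberTheory.Irrationality.PAdicZetaValues
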